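import Summits.BirchSwinnertonDyer.BirchSwinnertonDyer.Theorems.ByReductionTypeAtTwoMultTransportP49KernelTwistModule
import Literature.NumberTheory.EllipticCurves.ZpExtensionGaloisTwistWeilDual
import Literature.NumberTheory.EllipticCurves.ZpExtensionTwistedEigenvectorFiniteProofs
import Literature.NumberTheory.EllipticCurves.Greenberg1999.LocalH1DivisibleCyclotomicProofs
import Literature.NumberTheory.EllipticCurves.WeilPairingProofs
import Literature.NumberTheory.EllipticCurves.WeilPairingTateDual
import Literature.NumberTheory.EllipticCurves.GaloisActionProofs
import Literature.NumberTheory.GaloisRepresentations.LocalDualityTwoZero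
import Literature.NumberTheory.GaloisRepresentations.LocalGlobalCohomologyTateProofs
import Literature.NumberTheory.GaloisRepresentations.TateH2VanishingArchimedean
import Literature.NumberTheory.GaloisRepresentations.BrauerTower
import Literature.NumberTheory.Automorphic.AdicCompletionLocalField
import HarnessLib

/-!
# T-42-mult in the kernel, LV — P49-KERNEL (13): UNIFORM EXPONENTS for the LOCAL groups `H²(K_v, E[p^k](χ_u))`
# — `2` at the infinite places, `p^{2f}` at a finite place off a finite set of twists `u`

Cell `bsd-2adic` (run/shared/lean/pub/bsd-2adic/), seat `bsd-2adic-t42` GEN 19 (pen RC-337; memo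
`t42/DESIGN-T42-ADDENDUM-22` §A22.3 file (L)). HONEST FRAMING: research route; THEOREMS ONLY (no `def`, no named
fact, no instance, no `sorry`); nothing booked; BSD is not proved by any of this. PARTITION: X5@2 multiplicative
GV-transport rows (K4ᵐ B1·O1; input LEO of `P49Kernel.prop49_of_LEO`, p671196) × all p —
reduces-the-named-input-of; bears_on K4 19922 / 19923 (`--supports stmt-BirchSwinnertonDyer-19923`).

## What (Greenberg LNM 1716 p. 117: «The groups `Hⁿ(F_v, M)` have exponent `≤ 2`»; p. 125: «`H⁰(F_{v₀}, M^*)` …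
## is finite … for all but finitely many `s`»)

* `two_nsmul_galoisCohomology_two_infinitePlace` — at an infinite place `w` of a number field, `2 · H²(K_w, M) = 0`
  for every discrete `Γ_{K_w}`-module (`Γ_{K_w}` has order `≤ 2`; `Cor ∘ Res = index` from the trivial subgroup,
  `index_smul_eq_zero_of_resH_eq_zero`, and `H²` of the trivial group vanishes — a 2-cocycle on `1` is the
  coboundary of its value).
* **`exists_pow_smul_galoisCohomology_two_twisted_eq_zero`** — at a finite place `v` (elliptic `W/K`, `κ` cyclotomic):
  outside a finite set of integers `u ≡ 1 (mod p)` (`ZpExtension.finite_setOf_twisted_eigenvector` at a `σ₂ ∈ Γ_{K_v}`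
  moving `K_∞`, `exists_apply_resGal_ne_one_of_isCyclotomic`) there is `f` with `p^{2f} · H²(K_v, E[p^k](χ_u)) = 0`
  for every `k ≥ 1`: local Tate duality in bidegree `(2,0)` (`natCard_two_eq_natCard_invariants_homRep`:
  `#H²(K_v, M) = #(M^D)^{Γ_{K_v}}`), the invariants of `E[p^k](χ_u)^D ≅ E[p^k](χ_{u'})` (twisted Weil duality,
  transported to `μ(K̄_v)` by `tateDualTransfer`) inject into the `σ₂`-eigenvectors `{P ∈ E[p^k] : σ₂P = u^{κσ₂}P}`,
  killed by `p^f`, hence into `E[p^f]` of order `p^{2f}` (`card_torsionPoints_eq_sq_holds`); a `p^k`-torsion group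
  of order `≤ p^{2f}` is killed by `p^{2f}`.

References: [GreenbergLNM1716] §4 pp. 117, 125; [SerreGaloisCohomology1997] I §2.4 Prop. 9, II §5.2 Thm. 2;
[MilneADT2006] I Cor. 2.3.
-/

set_option autoImplicit false
set_option linter.dupNamespace false

noncomputable section

open scoped Classical

universe u

namespace Summit.BirchSwinnertonDyer.BirchSwinnertonDyer.Theorems.P49Kernel

open NumberField IsDedekindDomain Field WeierstrassCurve CategoryTheory
  Literature.NumberTheory.EllipticCurves Literature.NumberTheory.GaloisRepresentations
  _root_.TopRep _root_.ContRepresentation _root_.ContinuousCohomology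

/-! ## §1. The trivial group has no `H²`; `#Γ · H²(Γ, M) = 0` for a finite discrete profinite `Γ` -/

section Finite

variable {Γ : Type u} [Group Γ] [TopologicalSpace Γ] [IsTopologicalGroup Γ] [LocallyCompactSpace Γ]
  {M : Type u} [AddCommGroup M] [TopologicalSpace M] [DiscreteTopology M]

/-- **`H²` of a trivial group vanishes**: a continuous `2`-cocycle `f` on a group with one element is the
coboundary of the constant cochain `f(1,1)`. [cite: SerreGaloisCohomology1997, I §2.2] -/
theorem subsingleton_H_two_of_subsingleton [Subsingleton Γ] (ρ : ContinuousRep Γ ℤ M) :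
    Subsingleton (continuousCohomology 2 ρ.toTopRep) := by
  refine ⟨fun x y ↦ ?_⟩
  suffices h : ∀ z : continuousCohomology 2 ρ.toTopRep, z = 0 by rw [h x, h y]
  intro z
  obtain ⟨f, rfl⟩ := twoCocycleClass_surjective ρ.toTopRep z
  refine (twoCocycleClass_eq_zero_iff ρ.toTopRep f).mpr ⟨ContinuousMap.const Γ (f.1 (1, 1)), fun σ τ ↦ ?_⟩
  rw [Subsingleton.elim σ 1, Subsingleton.elim τ 1, ContinuousMap.const_apply, mul_one]
  change f.1 (1, 1) = ρ 1 (f.1 (1, 1)) - f.1 (1, 1) + f.1 (1, 1)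
  rw [← ContinuousRep.toRepresentation_apply, map_one, Module.End.one_apply, sub_add_cancel]

end Finite

/-! ## §2. Infinite places: `2 · H²(K_w, M) = 0` -/

section Infinite

variable {K : Type} [Field K] [NumberField K] {M : Type} [AddCommGroup M] [TopologicalSpace M]
  [DiscreteTopology M]

omit [NumberField K] in
/-- **At an infinite place, `2` kills `H²(K_w, M)`** for every discrete `Γ_{K_w}`-module `M`: `Γ_{K_w}` is finite
of order `≤ 2` (`natCard_absoluteGaloisGroup_completion_infinitePlace_le_two`), hence discrete, so the trivial
subgroup is open of index `#Γ_{K_w}`; `Cor ∘ Res = index` (`index_smul_eq_zero_of_resH_eq_zero`) with §1.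
Greenberg p. 117: «The groups `Hⁿ(F_v, M)` have exponent `≤ 2` for all `n ≥ 1`».
[cite: GreenbergLNM1716, §4 p. 117] [cite: SerreGaloisCohomology1997, I §2.4 Prop. 9] -/
theorem two_nsmul_galoisCohomology_two_infinitePlace (w : InfinitePlace K)
    (ρ : DiscreteGaloisModule w.Completion M) (x : galoisCohomology ρ 2) : 2 • x = 0 := by
  haveI := finite_absoluteGaloisGroup_completion_infinitePlace w
  have hbot : IsOpen ((⊥ : Subgroup (absoluteGaloisGroup w.Completion)) : Set (absoluteGaloisGroup w.Completion)) :=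
    isOpen_discrete _
  have hsub : Subsingleton (continuousCohomology 2
      (ρ.restrict (Literature.NumberTheory.GaloisRepresentations.subgroupIncl
        (⊥ : Subgroup (absoluteGaloisGroup w.Completion)))).toTopRep) :=
    subsingleton_H_two_of_subsingleton _
  have hres : resH (⊥ : Subgroup (absoluteGaloisGroup w.Completion)) ρ 2 x = 0 := hsub.elim _ _
  have h := index_smul_eq_zero_of_resH_eq_zero ρ ⊥ hbot x hres
  rw [Subgroup.index_bot] at h
  have hle := natCard_absoluteGaloisGroup_completion_infinitePlace_le_two w
  have hpos : 0 < Nat.card (absoluteGaloisGroup w.Completion) := Nat.card_pos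
  interval_cases hc : Nat.card (absoluteGaloisGroup w.Completion)
  · rw [one_smul] at h
    exact (congrArg (fun t ↦ 2 • t) h).trans (smul_zero _)
  · exact h

end Infinite

/-! ## §3. Finite places: `p^{2f} · H²(K_v, E[p^k](χ_u)) = 0` off a finite set of twists -/

section FinitePlace

variable {K : Type} [Field K] [NumberField K] (W : WeierstrassCurve K) [W.IsElliptic] (p : ℕ) [Fact p.Prime]
  (κ : ZpExtension K p) (v : HeightOneSpectrum (𝓞 K))

/-- A `p^k`-torsion group of order at most `p^n` is killed by `p^n`. [folklore] -/
theorem pow_smul_eq_zero_of_card_le {A : Type u} [AddCommGroup A] [Finite A] {k n : ℕ}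
    (hk : ∀ a : A, p ^ k • a = 0) (hcard : Nat.card A ≤ p ^ n) (a : A) : p ^ n • a = 0 := by
  have hp := (Fact.out : p.Prime)
  obtain ⟨j, -, hj⟩ := (Nat.dvd_prime_pow hp).mp (addOrderOf_dvd_iff_nsmul_eq_zero.mpr (hk a))
  have hdvd : addOrderOf a ∣ Nat.card A := addOrderOf_dvd_natCard a
  have hjn : j ≤ n := by
    have h1 : p ^ j ≤ p ^ n := (Nat.le_of_dvd Nat.card_pos (hj ▸ hdvd)).trans hcard
    exact (Nat.pow_le_pow_iff_right hp.one_lt).mp h1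
  obtain ⟨d, hd⟩ := Nat.exists_eq_add_of_le hjn
  rw [hd, pow_add, mul_comm, mul_smul, ← hj, addOrderOf_nsmul_eq_zero, smul_zero]

/-- **Twisted eigenvectors of the Tate dual are killed by `p^f` (any `p`)**: if `p^f` kills every `P ∈ E[p^k]` with
`σ₀ • P = u^{κ(σ₀)} • P` (`σ₀ = res σ₂`), then `p^f` kills every element of `E[p^k](χ_u)^D` fixed by `σ₂`, read
through the Weil duality `w : E[p^k](χ_{u'}) ⥲ E[p^k](χ_u)^D` (`u u' ≡ 1`). (General-`p` form of the cell's
`pow_smul_tateDual_eq_zero_of_fixed`; Greenberg p. 125.) [cite: GreenbergLNM1716, §4 p. 125] -/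
theorem pow_smul_tateDual_eq_zero_of_fixed' (k : ℕ) {u u' : ℤ} (hu : (p : ℤ) ∣ u - 1) (hu' : (p : ℤ) ∣ u' - 1)
    (huu' : ((p : ℤ) ^ k) ∣ u * u' - 1)
    (e : W.geomTorsion ((p ^ k : ℕ) : ℤ) → W.geomTorsion ((p ^ k : ℕ) : ℤ) → AlgebraicClosure K)
    (hμ : ∀ S T, e S T ^ (p ^ k) = 1)
    (hadd₁ : ∀ S₁ S₂ T, e (S₁ + S₂) T = e S₁ T * e S₂ T)
    (hadd₂ : ∀ S T₁ T₂, e S (T₁ + T₂) = e S T₁ * e S T₂)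
    (hgal : ∀ (σ : absoluteGaloisGroup K) (S T : W.geomTorsion ((p ^ k : ℕ) : ℤ)), σ • e S T = e (σ • S) (σ • T))
    (hnondeg : ∀ T, (∀ S, e S T = 1) → T = 0) [Finite (W.geomTorsion ((p ^ k : ℕ) : ℤ))]
    {E : Type} [Field E] [Algebra K E] (σ₂ : absoluteGaloisGroup E) {f : ℕ}
    (hf : ∀ P : W.geomTorsion ((p ^ k : ℕ) : ℤ),
      absGaloisRestrict K E σ₂ • P = (u ^ κ.twistExponent k (absGaloisRestrict K E σ₂)) • P → p ^ f • P = 0)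
    (m : DiscreteGaloisModule.TateDual K (W.geomTorsion ((p ^ k : ℕ) : ℤ)) (p ^ k))
    (hm : (W.twistedTorsionGaloisModule p κ k u hu).tateDual (p ^ k) (absGaloisRestrict K E σ₂) m = m) :
    p ^ f • m = 0 := by
  set wJ := W.twistedWeilDual p κ k hu hu' huu' e hμ hadd₁ hadd₂ hgal with hwJ
  set T := W.twistedWeilDualInv p κ k hu hu' huu' e hμ hadd₁ hadd₂ hgal hnondeg m with hT
  have hmT : wJ T = m := W.twistedWeilDual_inv_apply p κ k hu hu' huu' e hμ hadd₁ hadd₂ hgal hnondeg m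
  set g := absGaloisRestrict K E σ₂ with hg
  have h1 : W.twistedTorsionGaloisModule p κ k u' hu' g T = T := by
    apply W.twistedWeilDual_injective p κ k hu hu' huu' e hμ hadd₁ hadd₂ hgal hnondeg
    have h := congrArg (fun L ↦ L T) (wJ.isIntertwining' g)
    change wJ (W.twistedTorsionGaloisModule p κ k u' hu' g T) =
      ((W.twistedTorsionGaloisModule p κ k u hu).tateDual (p ^ k)) g (wJ T) at h
    rw [h, hmT]
    exact hm
  rw [ZpExtension.galoisTwist_apply_apply, torsionGaloisModule_apply_apply] at h1
  have h2 : g • T = (u ^ κ.twistExponent k g) • T := by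
    have h3 := congrArg (fun X ↦ (u ^ κ.twistExponent k g) • X) h1
    rw [smul_smul, ← mul_pow,
      ZpExtension.pow_zsmul_eq_of_dvd_sub (W.pow_nsmul_geomTorsion_pow p k) huu', one_pow, one_smul] at h3
    exact h3
  have h4 : p ^ f • T = 0 := hf T h2
  rw [← hmT, ← map_nsmul, h4, map_zero]

/-- **UNIFORM EXPONENT FOR THE LOCAL `H²` AT A FINITE PLACE, OFF A FINITE SET OF TWISTS.** For `κ` cyclotomic and a
finite place `v`: outside a finite set of integers `u ≡ 1 (mod p)` there is `f` with
`p^{2f} · H²(K_v, E[p^k](χ_u)) = 0` for every `k ≥ 1` (see the module docstring).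
[cite: GreenbergLNM1716, §4 p. 125] [cite: SerreGaloisCohomology1997, II §5.2 Thm. 2] [cite: MilneADT2006, Ch. I, Cor. 2.3] -/
theorem exists_pow_smul_galoisCohomology_two_twisted_eq_zero (hκ : κ.IsCyclotomic) :
    ∃ Ev : Set ℤ, Ev.Finite ∧ ∀ (u : ℤ) (hu : (p : ℤ) ∣ u - 1), u ∉ Ev → ∃ f : ℕ,
      ∀ (k : ℕ) [Finite (W.geomTorsion ((p ^ k : ℕ) : ℤ))], 0 < k →
      ∀ z : galoisCohomology ((W.twistedTorsionGaloisModule p κ k u hu).toLocal (Sum.inr v)) 2, p ^ (2 * f) • z = 0 := by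
  -- a local element moving `K_∞`, and the finite exceptional set of twists
  obtain ⟨σ₂, hσ₂⟩ := Greenberg1999.exists_apply_resGal_ne_one_of_isCyclotomic hκ v
  have hσ₂' : absGaloisRestrict K (v.adicCompletion K) σ₂ ∉ κ.kerSubgroup := fun h ↦ hσ₂ h
  refine ⟨_, ZpExtension.finite_setOf_twisted_eigenvector κ W (absGaloisRestrict K (v.adicCompletion K) σ₂)
    (absGaloisRestrict K (v.adicCompletion K) σ₂) hσ₂', fun u hu huE ↦ ?_⟩
  -- `p^f` kills the `σ₂`-eigenvectors `{P : σ₂ P = u^{κ σ₂} P}` at every level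
  have hf : ∃ f : ℕ, ∀ (J : ℕ) (P : W.geomTorsion ((p ^ J : ℕ) : ℤ)),
      absGaloisRestrict K (v.adicCompletion K) σ₂ • P =
        (u ^ κ.twistExponent J (absGaloisRestrict K (v.adicCompletion K) σ₂)) • P → p ^ f • P = 0 := by
    by_contra hcon
    push Not at hcon
    exact huE ⟨hu, hcon⟩
  obtain ⟨f, hf⟩ := hf
  refine ⟨f, fun k _ hk ↦ ?_⟩
  -- level-`k` data
  haveI : CharZero (v.adicCompletion K) := LocalField.charZero_adicCompletion v
  haveI : NeZero (p ^ k) := ⟨pow_ne_zero _ (Fact.out : p.Prime).ne_zero⟩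
  obtain ⟨e, hμ, hadd₁, hadd₂, -, hnondeg, hgal⟩ := WeierstrassCurve.exists_weilPairing_holds W (p ^ k)
    (by calc (2 : ℕ) ≤ p := (Fact.out : p.Prime).two_le
      _ = p ^ 1 := (pow_one p).symm
      _ ≤ p ^ k := Nat.pow_le_pow_right (Fact.out : p.Prime).pos hk)
    (by exact_mod_cast pow_ne_zero k (Fact.out : p.Prime).ne_zero)
  obtain ⟨u', hu', huu'⟩ := exists_inverse_mod_pow hu k
  set ρ := W.twistedTorsionGaloisModule p κ k u hu with hρ
  -- work with `ρ|_{K_v}` written as `restrictField` (definitionally `ρ.toLocal (inr v)`)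
  intro z
  suffices key : ∀ z' : galoisCohomology (ρ.restrictField (v.adicCompletion K)) 2, p ^ (2 * f) • z' = 0 from key z
  intro z'
  -- local Tate duality `(2, 0)`: `#H²(K_v, M) = #(M^D)^{Γ_{K_v}}`
  obtain ⟨hfin, hcard⟩ := natCard_two_eq_natCard_invariants_homRep (v.adicCompletion K)
    (ρ.restrictField (v.adicCompletion K)) (W.pow_nsmul_geomTorsion_pow p k)
  haveI := hfin
  -- the invariants inject into `E[p^f]`
  have hinv_le : Nat.card ((ρ.restrictField (v.adicCompletion K)).homRep
      (DiscreteGaloisModule.mu (v.adicCompletion K) (p ^ k))).toTopRep.ρ.invariants ≤ p ^ (2 * f) := by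
    -- step 1: every invariant `w` gives a `σ₂`-fixed Tate-dual element `m`, hence `p^f • w = 0`
    have hkill : ∀ w : ((ρ.restrictField (v.adicCompletion K)).homRep
        (DiscreteGaloisModule.mu (v.adicCompletion K) (p ^ k))).toTopRep.ρ.invariants,
        p ^ f • (w : HomCarrier (W.geomTorsion ((p ^ k : ℕ) : ℤ)) (DiscreteGaloisModule.MuCarrier (v.adicCompletion K) (p ^ k))) = 0 := by
      intro w
      set m := (tateDualTransferEquiv v (p ^ k) (M := W.geomTorsion ((p ^ k : ℕ) : ℤ))).symm w.1 with hmdef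
      have hmw : tateDualTransfer v (p ^ k) m = w.1 :=
        (tateDualTransferEquiv v (p ^ k) (M := W.geomTorsion ((p ^ k : ℕ) : ℤ))).apply_symm_apply w.1
      have hfix : ρ.tateDual (p ^ k) (absGaloisRestrict K (v.adicCompletion K) σ₂) m = m := by
        apply (tateDualTransferEquiv v (p ^ k) (M := W.geomTorsion ((p ^ k : ℕ) : ℤ))).injective
        change tateDualTransfer v (p ^ k) (ρ.tateDual (p ^ k) (absGaloisRestrict K (v.adicCompletion K) σ₂) m) =
          tateDualTransfer v (p ^ k) m
        have hw := w.2 σ₂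
        change ((ρ.restrictField (v.adicCompletion K)).homRep (DiscreteGaloisModule.mu (v.adicCompletion K) (p ^ k))) σ₂ w.1 = w.1 at hw
        rw [hmw]
        refine (HomCarrier.ext fun x ↦ ?_).trans hw
        rw [tateDualTransfer_apply, DiscreteGaloisModule.tateDual_apply_apply_apply,
          ContinuousRep.homRep_apply_apply_apply, muTransfer_mu, ← hmw, tateDualTransfer_apply, ← map_inv]
        rfl
      have hm0 := pow_smul_tateDual_eq_zero_of_fixed' W p κ k hu hu' huu' e hμ hadd₁ hadd₂ hgal hnondeg σ₂ (hf k)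
        m hfix
      rw [← hmw]
      change p ^ f • (tateDualTransferEquiv v (p ^ k) (M := W.geomTorsion ((p ^ k : ℕ) : ℤ))) m = 0
      rw [← map_nsmul, hm0, map_zero]
    -- step 2: `w ↦ w⁻¹(m(w)) = T ∈ E[p^k]` with `p^f T = 0`, injectively into `E[p^f]`
    have hTmem : ∀ w : ((ρ.restrictField (v.adicCompletion K)).homRep
        (DiscreteGaloisModule.mu (v.adicCompletion K) (p ^ k))).toTopRep.ρ.invariants,
        ((W.twistedWeilDualInv p κ k hu hu' huu' e hμ hadd₁ hadd₂ hgal hnondeg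
          ((tateDualTransferEquiv v (p ^ k) (M := W.geomTorsion ((p ^ k : ℕ) : ℤ))).symm w.1) :
            W.geomTorsion ((p ^ k : ℕ) : ℤ)) : W.geomPoints) ∈ W.geomTorsion ((p ^ f : ℕ) : ℤ) := by
      intro w
      have h := hkill w
      rw [← (tateDualTransferEquiv v (p ^ k) (M := W.geomTorsion ((p ^ k : ℕ) : ℤ))).apply_symm_apply w.1,
        ← map_nsmul, EmbeddingLike.map_eq_zero_iff] at h
      have h2 := congrArg (W.twistedWeilDualInv p κ k hu hu' huu' e hμ hadd₁ hadd₂ hgal hnondeg) h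
      rw [map_nsmul, map_zero] at h2
      show ((p ^ f : ℕ) : ℤ) • ((W.twistedWeilDualInv p κ k hu hu' huu' e hμ hadd₁ hadd₂ hgal hnondeg
          ((tateDualTransferEquiv v (p ^ k) (M := W.geomTorsion ((p ^ k : ℕ) : ℤ))).symm w.1) :
            W.geomTorsion ((p ^ k : ℕ) : ℤ)) : W.geomPoints) = 0
      rw [natCast_zsmul, ← AddSubgroupClass.coe_nsmul, h2]
      rfl
    let ι : ((ρ.restrictField (v.adicCompletion K)).homRep (DiscreteGaloisModule.mu (v.adicCompletion K) (p ^ k))).toTopRep.ρ.invariants →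
        W.geomTorsion ((p ^ f : ℕ) : ℤ) := fun w ↦ ⟨_, hTmem w⟩
    have hι : Function.Injective ι := by
      intro w w' h
      have h' : (W.twistedWeilDualInv p κ k hu hu' huu' e hμ hadd₁ hadd₂ hgal hnondeg
            ((tateDualTransferEquiv v (p ^ k) (M := W.geomTorsion ((p ^ k : ℕ) : ℤ))).symm w.1) :
              W.geomTorsion ((p ^ k : ℕ) : ℤ)) =
          W.twistedWeilDualInv p κ k hu hu' huu' e hμ hadd₁ hadd₂ hgal hnondeg
            ((tateDualTransferEquiv v (p ^ k) (M := W.geomTorsion ((p ^ k : ℕ) : ℤ))).symm w'.1) :=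
        Subtype.ext (congrArg (fun t : W.geomTorsion ((p ^ f : ℕ) : ℤ) ↦ (t : W.geomPoints)) h)
      have h'' := (W.twistedWeilDualEquiv p κ k hu hu' huu' e hμ hadd₁ hadd₂ hgal hnondeg).symm.injective h'
      exact Subtype.ext ((tateDualTransferEquiv v (p ^ k) (M := W.geomTorsion ((p ^ k : ℕ) : ℤ))).symm.injective h'')
    haveI : NeZero (p ^ f) := ⟨pow_ne_zero _ (Fact.out : p.Prime).ne_zero⟩
    haveI : Finite (W.geomTorsion ((p ^ f : ℕ) : ℤ)) := finite_geomTorsion_of_neZero W (p ^ f)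
    have hEf : Nat.card (W.geomTorsion ((p ^ f : ℕ) : ℤ)) = (p ^ f) ^ 2 :=
      card_torsionPoints_eq_sq_holds W (AlgebraicClosure K) (by exact_mod_cast pow_ne_zero f (Fact.out : p.Prime).ne_zero)
    calc Nat.card _ ≤ Nat.card (W.geomTorsion ((p ^ f : ℕ) : ℤ)) := Nat.card_le_card_of_injective ι hι
      _ = p ^ (2 * f) := by rw [hEf, ← pow_mul, mul_comm]
  rw [← hcard] at hinv_le
  -- `H²(K_v, M)` is `p^k`-torsion of order `≤ p^{2f}`
  refine pow_smul_eq_zero_of_card_le p (k := k) (fun a ↦ ?_) hinv_le z'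
  have h := (ρ.restrictField (v.adicCompletion K)).smul_continuousCohomology_eq_zero ((p ^ k : ℕ) : ℤ)
    (fun m ↦ by rw [natCast_zsmul]; exact W.pow_nsmul_geomTorsion_pow p k m) 2 a
  rwa [Nat.cast_smul_eq_nsmul] at h

end FinitePlace

end Summit.BirchSwinnertonDyer.BirchSwinnertonDyer.Theorems.P49Kernel

end
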